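import Summits.BirchSwinnertonDyer.BirchSwinnertonDyer.Theorems.CMKolyvaginAtInertTwoPairDataAtTwo
import HarnessLib

/-!
# Route `CMKolyvaginAtInertTwo`, crux `CMKolyvaginExactAtInertTwo` (stmt-BirchSwinnertonDyer-24277):
# THE VALUE FORMULA `hCTV` WITH THE KILL CLAUSE FROM ITS TWO MEMBER FORMULAS (pure bookkeeping)

Seat `bsd-line-cmk2-p1` g17 (cell `bsd-print-cf2`); helper (`--supports stmt-BirchSwinnertonDyer-24277`).
THEOREMS ONLY (pure algebra on the Literature carrier `KolyvaginDescent.SplitDataM`): no definition,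
no named fact, no `sorry`; no item is closed; BSD is not proved by this.

T2 KIT INTERFACE REPAIR (KERNEL-STATUS-p2-port.md §17). The kill-clause telescope
`card_mul_card_le_two_pow_two_mul_of_injective_of_kill` (this seat) asks McCallum's Cassels–Tate value
formula `hCTV` only for test classes with `(p^k) • t = 0`, `k` the exponent killing the two lift groups.
This is seat g14's splitting `hCTV_of_members` (p691010) with that clause threaded to the two MEMBER
formulas: `hV₁` (even depth, member `E^{ε}`) and `hV₂` (odd depth, member `E^{−ε}`) are now asked only
for `t₁`, `t₂` with `(p^k) • J₁ t₁ = 0`, `(p^k) • J₂ t₂ = 0` — the shape the re-based member formulas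
over `ℚ` (`hV₁/hV₂_canonical_of_kill`, p708946) deliver once `L ≥ k` (their clause `2^{2M₀'} • t = 0`
at the numeric parameter `M₀' := μ`, `2μ ≥ k`). Proof verbatim g14's.

* `hCTV_of_members_of_kill`.

References: [McCallumLMS1991] §4 Prop. 4.7, §5 Lemma 5.3, Thm. 5.4 (proof); [Kolyvagin1989Izv] §3.
-/

-- single-conjunct summit: `Summit.BirchSwinnertonDyer.BirchSwinnertonDyer.…` repeats the name by design
set_option linter.dupNamespace false
set_option autoImplicit false

noncomputable section

open scoped Classical
open Literature.NumberTheory.EllipticCurves Literature.NumberTheory.EllipticCurves.KolyvaginDescent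

namespace Summit.BirchSwinnertonDyer.BirchSwinnertonDyer.Theorems.KolyvaginPairDataTwo

/-- **`hCTV` with the kill clause `(p^k) • t = 0` of a pairing without cross terms from its two member
formulas asked only for `(p^k) • J₁ t₁ = 0`, `(p^k) • J₂ t₂ = 0`.** Otherwise as `hCTV_of_members`:
`Sd` split descent data on `V'`; `J₁ : T₁ → V'`, `J₂ : T₂ → V'` injective with
`Sd.Sel ≤ J₁(T₁) + J₂(T₂)`, pure parts read off by the eigengroups; `P` on `Sd.Sel` with
`P(J₁t₁ + J₂t₂, J₁t₁' + J₂t₂') = Q₁ t₁ t₁' + Q₂ t₂ t₂'`; `Q₁` satisfies McCallum's value formula for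
EVEN depth, `Q₂` for ODD depth. [cite: McCallumLMS1991, §4 Prop. 4.7, §5 Lemma 5.3, Thm. 5.4 (proof)]
[cite: Kolyvagin1989Izv, §3] -/
theorem hCTV_of_members_of_kill {V' : Type*} [AddCommGroup V'] {Pl : Type*} (Sd : SplitDataM V' Pl)
    {T₁ T₂ R : Type*} [AddCommGroup T₁] [AddCommGroup T₂] [AddCommGroup R]
    (J₁ : T₁ →+ V') (J₂ : T₂ →+ V') (hJ₁ : Function.Injective J₁) (hJ₂ : Function.Injective J₂)
    (hSelJ : ∀ s ∈ Sd.Sel, ∃ t₁ t₂, s = J₁ t₁ + J₂ t₂)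
    (hpure₁ : ∀ t₁ t₂, J₁ t₁ + J₂ t₂ ∈ Sd.eig Sd.ε → J₂ t₂ = 0)
    (hpure₂ : ∀ t₁ t₂, J₁ t₁ + J₂ t₂ ∈ Sd.eig (-Sd.ε) → J₁ t₁ = 0)
    (k : ℕ) (P : Sd.Sel →+ Sd.Sel →+ R) (Q₁ : T₁ →+ T₁ →+ R) (Q₂ : T₂ →+ T₂ →+ R)
    (hP : ∀ (t₁ t₁' : T₁) (t₂ t₂' : T₂) (h : J₁ t₁ + J₂ t₂ ∈ Sd.Sel) (h' : J₁ t₁' + J₂ t₂' ∈ Sd.Sel),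
      P ⟨J₁ t₁ + J₂ t₂, h⟩ ⟨J₁ t₁' + J₂ t₂', h'⟩ = Q₁ t₁ t₁' + Q₂ t₂ t₂')
    (hV₁ : ∀ ℓ m : ℕ, Sd.Kol ℓ → KolSupp Sd.Kol (ℓ * m) → ¬ ℓ ∣ m → Even (ℓ * m).primeFactors.card →
      ∀ (j N a b : ℕ) (t₁ z₁ : T₁), J₁ t₁ ∈ Sd.Sel → ((Sd.p : ℤ) ^ j) • Sd.c (ℓ * m) = J₁ z₁ →
      J₁ z₁ ∈ Sd.Sel → ((Sd.p : ℤ) ^ k) • J₁ t₁ = 0 → ((Sd.p : ℤ) ^ N) • J₁ t₁ = 0 → (∀ q ∈ m.primeFactors, J₁ t₁ ∈ Sd.A q) →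
      Sd.M - Sd.M₀ ≤ j → N + Sd.M₀ ≤ Sd.M → N ≤ j → a + b + 1 = N →
      ((Sd.p : ℤ) ^ (a + (j - N))) • Sd.c m ∉ Sd.A ℓ → ((Sd.p : ℤ) ^ b) • J₁ t₁ ∉ Sd.A ℓ →
      Q₁ z₁ t₁ ≠ 0)
    (hV₂ : ∀ ℓ m : ℕ, Sd.Kol ℓ → KolSupp Sd.Kol (ℓ * m) → ¬ ℓ ∣ m → Odd (ℓ * m).primeFactors.card →
      ∀ (j N a b : ℕ) (t₂ z₂ : T₂), J₂ t₂ ∈ Sd.Sel → ((Sd.p : ℤ) ^ j) • Sd.c (ℓ * m) = J₂ z₂ →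
      J₂ z₂ ∈ Sd.Sel → ((Sd.p : ℤ) ^ k) • J₂ t₂ = 0 → ((Sd.p : ℤ) ^ N) • J₂ t₂ = 0 → (∀ q ∈ m.primeFactors, J₂ t₂ ∈ Sd.A q) →
      Sd.M - Sd.M₀ ≤ j → N + Sd.M₀ ≤ Sd.M → N ≤ j → a + b + 1 = N →
      ((Sd.p : ℤ) ^ (a + (j - N))) • Sd.c m ∉ Sd.A ℓ → ((Sd.p : ℤ) ^ b) • J₂ t₂ ∉ Sd.A ℓ →
      Q₂ z₂ t₂ ≠ 0) :
    ∀ ℓ m : ℕ, Sd.Kol ℓ → KolSupp Sd.Kol (ℓ * m) → ¬ ℓ ∣ m →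
      ∀ (j N a b : ℕ) (t : V') (ht : t ∈ Sd.Sel) (hz : ((Sd.p : ℤ) ^ j) • Sd.c (ℓ * m) ∈ Sd.Sel),
      ((Sd.p : ℤ) ^ k) • t = 0 → ((Sd.p : ℤ) ^ N) • t = 0 →
      t ∈ Sd.eig (Sd.ε * (-1) ^ (ℓ * m).primeFactors.card) →
      (∀ q ∈ m.primeFactors, t ∈ Sd.A q) → Sd.M - Sd.M₀ ≤ j → N + Sd.M₀ ≤ Sd.M → N ≤ j →
      a + b + 1 = N →
      ((Sd.p : ℤ) ^ (a + (j - N))) • Sd.c m ∉ Sd.A ℓ → ((Sd.p : ℤ) ^ b) • t ∉ Sd.A ℓ →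
      P ⟨_, hz⟩ ⟨t, ht⟩ ≠ 0 := by
  intro ℓ m hℓ hsupp hndvd j N a b t ht hz hk hN hte hAq hj hNM hNj hab hcm hbt
  -- the class `z = p^j c(ℓm)` and the test class `t` in coordinates
  obtain ⟨z₁, z₂, hz12⟩ := hSelJ _ hz
  obtain ⟨t₁, t₂, rfl⟩ := hSelJ t ht
  have hzeig : ((Sd.p : ℤ) ^ j) • Sd.c (ℓ * m) ∈ Sd.eig (Sd.ε * (-1) ^ (ℓ * m).primeFactors.card) :=
    AddSubgroup.zsmul_mem _ (Sd.c_eig (ℓ * m) hsupp) _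
  have hval : P ⟨_, hz⟩ ⟨J₁ t₁ + J₂ t₂, ht⟩ = Q₁ z₁ t₁ + Q₂ z₂ t₂ := by
    have hz' : J₁ z₁ + J₂ z₂ ∈ Sd.Sel := by rw [← hz12]; exact hz
    have heq : (⟨_, hz⟩ : Sd.Sel) = ⟨J₁ z₁ + J₂ z₂, hz'⟩ := Subtype.ext hz12
    rw [heq]
    exact hP z₁ t₁ z₂ t₂ hz' ht
  rw [hval]
  rcases Nat.even_or_odd (ℓ * m).primeFactors.card with hev | hodd
  · -- EVEN depth: everything lives on the first member
    rw [hev.neg_one_pow, mul_one] at hte hzeig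
    have ht2 : J₂ t₂ = 0 := hpure₁ t₁ t₂ hte
    rw [hz12] at hzeig
    have hz2 : J₂ z₂ = 0 := hpure₁ z₁ z₂ hzeig
    have ht20 : t₂ = 0 := hJ₂ (by rw [ht2, map_zero])
    have hz20 : z₂ = 0 := hJ₂ (by rw [hz2, map_zero])
    rw [ht20, hz20]
    simp only [map_zero, add_zero]
    rw [ht2, add_zero] at ht hk hN hAq hbt
    rw [hz2, add_zero] at hz12
    have hzSel : J₁ z₁ ∈ Sd.Sel := by rw [← hz12]; exact hz
    exact hV₁ ℓ m hℓ hsupp hndvd hev j N a b t₁ z₁ ht hz12 hzSel hk hN hAq hj hNM hNj hab hcm hbt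
  · -- ODD depth: everything lives on the second member
    rw [hodd.neg_one_pow, mul_neg_one] at hte hzeig
    have ht1 : J₁ t₁ = 0 := hpure₂ t₁ t₂ hte
    rw [hz12] at hzeig
    have hz1 : J₁ z₁ = 0 := hpure₂ z₁ z₂ hzeig
    have ht10 : t₁ = 0 := hJ₁ (by rw [ht1, map_zero])
    have hz10 : z₁ = 0 := hJ₁ (by rw [hz1, map_zero])
    rw [ht10, hz10]
    simp only [map_zero, zero_add]
    rw [ht1, zero_add] at ht hk hN hAq hbt
    rw [hz1, zero_add] at hz12
    have hzSel : J₂ z₂ ∈ Sd.Sel := by rw [← hz12]; exact hz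
    exact hV₂ ℓ m hℓ hsupp hndvd hodd j N a b t₂ z₂ ht hz12 hzSel hk hN hAq hj hNM hNj hab hcm hbt

end Summit.BirchSwinnertonDyer.BirchSwinnertonDyer.Theorems.KolyvaginPairDataTwo

end
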